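import Summits.QuantumAdvantage.QuantumAdvantage.Theorems.SosSandwichPseudoBoundedAAClassicalCornerQueryConcentration
import Summits.QuantumAdvantage.QuantumAdvantage.Theorems.SosSandwichPseudoBoundedAASymmetricCornerExponents
import HarnessLib

/-!
# Crux `PseudoBoundedAA` (stmt-QuantumAdvantage-15237, route SosSandwich) — the query-concentration law `4·Var ≤ Σⱼ δ̄ⱼ²`
# is SHARP: equality on the uniform dictator mixtures

Support file (`--supports stmt-QuantumAdvantage-15237`), companion of `…ClassicalCornerQueryConcentration`
(`four_boolVariance_le_sum_queryProb_sq`: `4·Var[p] ≤ Σⱼ δ̄ⱼ²` for every nonnegative mixture of decision trees).  For the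
uniform mixture of the `n` dictator trees "read `x_k`, output it" (`p_n = |x|/n`, the tree's `linearFamily`): every query
probability is `δ̄ⱼ = 1/n` (`queryProb_dictatorMixture`), so `Σⱼ δ̄ⱼ² = 1/n = 4·Var[p_n]`
(`four_boolVariance_eq_sum_queryProb_sq_dictatorMixture`): the constant `4` and the exponent `2` cannot be improved, for every `n`.

Honest label: sharpness certificate for an elementary law on a corner of an open conjecture; no registered stub, crux or summit
is closed.  Sources: R. O'Donnell, M. Saks, O. Schramm, R. Servedio, FOCS 2005, Thm 3.2; R. O'Donnell, *Analysis of Boolean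
Functions* (2014) §8.6.
-/

set_option linter.dupNamespace false

noncomputable section

namespace Summit.QuantumAdvantage.QuantumAdvantage.Theorems.SosSandwich

open Finset Function
open Literature.Computability.Complexity Literature.Computability.QuantumComplexity

namespace ClassicalCornerQueryConcentration

/-- The dictator tree "read `x_k`, output it" reads exactly `{k}` on every input. [cite: Wolf2002, §2.1] -/
theorem queries_dictator {n : ℕ} (k : Fin n) (x : Fin n → Bool) :
    (DecisionTree.query k (DecisionTree.leaf false) (DecisionTree.leaf true) : DecisionTree n).queries x = {k} := by
  rw [DecisionTree.queries_query, DecisionTree.queries_leaf, DecisionTree.queries_leaf]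
  split_ifs <;> rfl

/-- **Query probabilities of the uniform dictator mixture**: with weights `1/n` on the `n` dictator trees, every variable is
read with probability exactly `δ̄ⱼ = 1/n`. [cite: OdonnellEtAl2005, Thm 3.2 (setting)] -/
theorem queryProb_dictatorMixture {n : ℕ} (hn : 1 ≤ n) (j : Fin n) :
    ∑ k : Fin n, (1 / (n : ℝ)) *
        (((Finset.univ.filter fun x : Fin n → Bool =>
            j ∈ (DecisionTree.query k (DecisionTree.leaf false) (DecisionTree.leaf true) : DecisionTree n).queries x).card
              : ℝ) / (2 : ℝ) ^ n) = 1 / (n : ℝ) := by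
  classical
  have hn0 : (n : ℝ) ≠ 0 := by exact_mod_cast (show n ≠ 0 by omega)
  have h2n : (2 : ℝ) ^ n ≠ 0 := by positivity
  have hcard : ∀ k : Fin n, ((Finset.univ.filter fun x : Fin n → Bool =>
      j ∈ (DecisionTree.query k (DecisionTree.leaf false) (DecisionTree.leaf true) : DecisionTree n).queries x).card : ℝ)
        = if j = k then (2 : ℝ) ^ n else 0 := by
    intro k
    simp_rw [queries_dictator, Finset.mem_singleton]
    by_cases hjk : j = k
    · rw [if_pos hjk, Finset.filter_true_of_mem fun _ _ => hjk, Finset.card_univ, BooleanCorner.card_cube_nat]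
      push_cast
      rfl
    · rw [if_neg hjk, Finset.filter_false_of_mem fun _ _ => hjk, Finset.card_empty]
      push_cast
      rfl
  simp_rw [hcard]
  rw [Finset.sum_eq_single j (fun k _ hkj => by rw [if_neg (Ne.symm hkj)]; simp) (fun h => (h (Finset.mem_univ j)).elim),
    if_pos rfl, div_self h2n, mul_one]

/-- **Sharpness of the query-concentration law.**  For the uniform dictator mixture `p_n = |x|/n` (`n ≥ 1`):
`4·Var[p_n] = 1/n = Σⱼ δ̄ⱼ²`, equality in `four_boolVariance_le_sum_queryProb_sq`. [cite: OdonnellEtAl2005, Thm 3.2] -/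
theorem four_boolVariance_eq_sum_queryProb_sq_dictatorMixture {n : ℕ} (hn : 1 ≤ n) :
    4 * boolVariance (∑ i : Fin n, MvPolynomial.C (1 / (n : ℝ)) * MvPolynomial.X i) =
      ∑ j : Fin n, (∑ k : Fin n, (1 / (n : ℝ)) *
        (((Finset.univ.filter fun x : Fin n → Bool =>
            j ∈ (DecisionTree.query k (DecisionTree.leaf false) (DecisionTree.leaf true) : DecisionTree n).queries x).card
              : ℝ) / (2 : ℝ) ^ n)) ^ 2 := by
  have hn0 : (n : ℝ) ≠ 0 := by exact_mod_cast (show n ≠ 0 by omega)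
  rw [SymmetricCorner.boolVariance_linearFamily hn]
  simp_rw [queryProb_dictatorMixture hn]
  rw [Finset.sum_const, Finset.card_univ, Fintype.card_fin, nsmul_eq_mul]
  field_simp

end ClassicalCornerQueryConcentration

end Summit.QuantumAdvantage.QuantumAdvantage.Theorems.SosSandwich

end
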